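import Summits.BirchSwinnertonDyer.BirchSwinnertonDyer.Theses.KatoDescentTamePotSupersingular
import Summits.BirchSwinnertonDyer.Rank1Residual.Partition.CornersCM
import Literature.NumberTheory.EllipticCurves.Kato2004.Condition1252
import HarnessLib

/-!
# Route `KatoDescentTamePotSupersingular` (rung K8, sub-rung B4 (t′), cell `bsd-potss`): the row crux
# `TameUpperNonsurjTower` (U₀-ns, item stmt-BirchSwinnertonDyer-19202; child of U₀ = item 19982)
# LOSES its CM rows and, at `p ≥ 5`, reads "tower not onto" as "`ρ̄_{E,p}` not onto" (a `--supports` file)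

After the Tamagawa-exact reading A161″ (`Theorems/KatoDescentTamePotSupersingularTameUpperDefectTowerSurj`,
kmc g6, p416834; glue item 19204) the irreducible defect rows of U₀ are the (t′) rank-`0` rows with
`E[p]` irreducible but `p`-adic tower image NOT onto — the row crux `TameUpperNonsurjTower` (route
rev 2). This file shrinks that crux twice, by TREE THEOREMS plus ONE published input:

* **CM rows are covered** (any `p`, any reduction): a CM curve of analytic rank `0` satisfies
  `BSD(E,p)` at every prime by the tree's row C8 (`bsdp_cm_rankZero`: Rubin 1991 /
  Burungale–Flach 2024 Cor. 2, the named fact `bsdTriple_of_hasCM_of_L_one_ne_zero`, + modularity),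
  hence the upper half `MissingUpperBoundAt W p` (`missingUpperBoundAt_of_hasCM_rankZero`). On (t′)
  these are the `j = 0` rows at `p ≡ 2 (mod 3)` (`e ∈ {3,6}`) and the `j = 1728` rows at
  `p ≡ 3 (mod 4)` (`e = 4`, including `p = 3`), whose mod-`p` image is a Cartan normaliser and
  never tower-surjective — the "CM-like rows" of the item's why-it-might-fail.
* **At `p ≥ 5` "tower not onto" is "`ρ̄_{E,p}` not onto"** (Serre's lifting lemma, tree theorem
  `serre_hasSurjectiveModNGaloisRep_pow_holds`, IV-23 Lemma 3): `not_hasSurjectiveModNGaloisRep_of_not_towerSurj`;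
  **at `p = 3` it is "`ρ̄_{E,9}` not onto"** (`forall_hasSurjectiveModNGaloisRep_three_pow_of_nine`):
  `not_hasSurjectiveModNGaloisRep_nine_of_not_towerSurj`.

The last theorem is the RESHAPED COMPOSITION of the row crux BY NAME: granted the CM triple,
modularity and GZK, `TameUpperNonsurjTower` follows from (i) the upper half on the NON-CM rank-`0`
(t′) rows at `p ≥ 5` with `E[p]` irreducible and `ρ̄_{E,p}` NOT onto (normaliser-of-Cartan /
exceptional images) and (ii) the same at `p = 3` with `ρ̄_{E,3}` irreducible and `ρ̄_{E,9}` not onto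
(2-group images and Elkies' 9-deficient classes). Nothing about (i), (ii) or the named facts is
asserted; the item is NOT closed (conditional helper). Seat `bsd-potss-k8t-c4`.

Why (i)/(ii) are the honest residue (recorded for the tenure planner, not used in the proofs):
Kato's integral divisibility Thm. 13.4 (3) (Astérisque 295, p. 226) needs `σ ∈ Gal(ℚ̄/ℚ(ζ_{p^∞}))`
with `Coker(σ − 1 : T → T)` free of rank one and `T/𝔪T` irreducible; for `T = T_pE` such a `σ` is
a unipotent element of the `p`-adic image reducing to a transvection mod `p`, which for irreducible
`E[p]` forces `ρ̄_{E,p} ⊇ SL₂(𝔽_p)` (Dickson), i.e. (12.5.2) at `p ≥ 5`; at `p = 3` the 9-deficient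
image meets `SL₂(ℤ/9)` in a copy of `SL₂(𝔽₃)` (no element of order `9`), so no such `σ` exists
either. Thm. 13.4 (2) (height-one primes not containing `p`) holds on these rows but leaves the
`μ`-part uncontrolled (Rubin, *Euler systems and modular elliptic curves*, Thm. 4.1 (ii): "divides
`p^t 𝓛`" for an unspecified `t`).

References: [Kato2004Asterisque] Thm. 13.4 (pp. 226), Thm. 14.5 (3) (p. 236), (12.5.2) (p. 222);
[SerreAbelianLadic1968] IV-23 Lemma 3; [BurungaleFlach2024] Thm. 1.1, Cor. 2; [Miller2011LMS] Def. 1.1.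
-/

set_option autoImplicit false
-- sibling precedent (`KatoDescentTamePotSupersingularAssembly.lean`): the directory name repeats the summit name
set_option linter.dupNamespace false

noncomputable section

open scoped Classical

namespace Summit.BirchSwinnertonDyer.BirchSwinnertonDyer.Theorems

open WeierstrassCurve Literature.NumberTheory.EllipticCurves
  Literature.NumberTheory.EllipticCurves.ModularForms
  Literature.NumberTheory.EllipticCurves.Rank1Residual
  Literature.NumberTheory.EllipticCurves.Rank1Residual.Typed
  Summit.BirchSwinnertonDyer.Rank1Residual.Additive
  Summit.BirchSwinnertonDyer.Rank1Residual
  Summit.BirchSwinnertonDyer.BirchSwinnertonDyer.Theses.KatoDescentTamePotSupersingular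

/-- **CM rows of analytic rank `0` have the upper half at EVERY prime** (granted the CM triple
`bsdTriple_of_hasCM_of_L_one_ne_zero` — Rubin 1991 / Burungale–Flach 2024 Cor. 2 —, modularity and
GZK for the finiteness of `Ш`): row C8 of the partition (`bsdp_cm_rankZero`) gives `BSD(E,p)`,
hence `MissingPPartAt W p`, hence its upper half. No reduction hypothesis at `p`.
[cite: BurungaleFlach2024, Thm. 1.1 and Cor. 2 (p. 4)] [cite: Miller2011LMS, §1 and Def. 1.1] -/
theorem missingUpperBoundAt_of_hasCM_rankZero (hCM : bsdTriple_of_hasCM_of_L_one_ne_zero)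
    (hmod : hasEntireLFunction_rat) (hGZK : rank_eq_analyticRank_of_analyticRank_le_one)
    (W : WeierstrassCurve ℚ) [W.IsElliptic] [W.IsGloballyMinimal] (p : ℕ) [Fact p.Prime]
    (hr : W.analyticRank = 0) (hcm : W.HasCM) : MissingUpperBoundAt W p := by
  haveI : Finite W.sha := (hGZK W (by omega)).2
  exact (lower_and_upper_of_missingPPartAt W p
    (missingPPartAt_of_bsdp W p (bsdp_cm_rankZero hCM hmod hcm hr))).2

/-- **At `p ≥ 5`, "`p`-adic tower not onto" is "`ρ̄_{E,p}` not onto"** — contrapositive of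
Serre's lifting lemma (tree theorem `serre_hasSurjectiveModNGaloisRep_pow_holds`).
[cite: SerreAbelianLadic1968, Ch. IV §3.4 Lemma 3 (IV-23)] -/
theorem not_hasSurjectiveModNGaloisRep_of_not_towerSurj (W : WeierstrassCurve ℚ) [W.IsElliptic]
    (p : ℕ) [Fact p.Prime] (h5 : 5 ≤ p)
    (hns : ¬ ∀ n : ℕ, W.HasSurjectiveModNGaloisRep (p ^ n : ℕ)) :
    ¬ W.HasSurjectiveModNGaloisRep p :=
  fun hsurj ↦ hns (serre_hasSurjectiveModNGaloisRep_pow_holds W p h5 hsurj)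

/-- **At `p = 3`, "`3`-adic tower not onto" is "`ρ̄_{E,9}` not onto"** (tree theorem
`forall_hasSurjectiveModNGaloisRep_three_pow_of_nine`; at an additive `3` the level `9` is genuinely
needed — Elkies' 9-deficient classes). [cite: SerreAbelianLadic1968, Ch. IV §3.4 Lemma 3 (IV-23)] -/
theorem not_hasSurjectiveModNGaloisRep_nine_of_not_towerSurj (W : WeierstrassCurve ℚ)
    [W.IsElliptic] (hns : ¬ ∀ n : ℕ, W.HasSurjectiveModNGaloisRep (3 ^ n : ℕ)) :
    ¬ W.HasSurjectiveModNGaloisRep 9 :=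
  fun h9 ↦ hns (forall_hasSurjectiveModNGaloisRep_three_pow_of_nine W h9)

/-- An odd prime other than `3` is at least `5`. [folklore] -/
private theorem five_le_of_prime_of_ne_two_of_ne_three {p : ℕ} (hp : p.Prime) (h2 : p ≠ 2)
    (h3 : p ≠ 3) : 5 ≤ p := by
  rcases Nat.lt_or_ge p 5 with h | h
  · have h2le := hp.two_le
    interval_cases p
    · exact absurd rfl h2
    · exact absurd rfl h3
    · exact absurd hp (by decide)
  · exact h

/-- **The irreducible NON-surjective-tower rows of U₀ reduce to the NON-CM rows with
`ρ̄_{E,p}` (resp. `ρ̄_{E,9}`) not onto** (granted the CM triple, modularity, GZK): the binder `hns`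
of `tameUpperDefectRankZero_of_nonsurj_of_redDefect_of_katoTam`, derived from its `p ≥ 5` non-CM
mod-`p` form and its `p = 3` non-CM mod-`9` form. Pure bookkeeping over the three theorems above.
[cite: SerreAbelianLadic1968, Ch. IV §3.4 Lemma 3 (IV-23)] [cite: BurungaleFlach2024, Thm. 1.1 and Cor. 2 (p. 4)] -/
theorem tameUpperNonsurj_of_cm_of_modP_of_modNine (hCM : bsdTriple_of_hasCM_of_L_one_ne_zero)
    (hmod : hasEntireLFunction_rat) (hGZK : rank_eq_analyticRank_of_analyticRank_le_one)
    (hns5 : ∀ (W : WeierstrassCurve ℚ) [W.IsElliptic] [W.IsGloballyMinimal] (p : ℕ) [Fact p.Prime],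
      W.analyticRank = 0 → 5 ≤ p → Addv W p → SubTprime W p → ¬ W.HasCM →
      W.HasIrreducibleModPGaloisRep p → ¬ W.HasSurjectiveModNGaloisRep p → MissingUpperBoundAt W p)
    (hns3 : ∀ (W : WeierstrassCurve ℚ) [W.IsElliptic] [W.IsGloballyMinimal] [Fact (Nat.Prime 3)],
      W.analyticRank = 0 → Addv W 3 → SubTprime W 3 → ¬ W.HasCM →
      W.HasIrreducibleModPGaloisRep 3 → ¬ W.HasSurjectiveModNGaloisRep 9 → MissingUpperBoundAt W 3)
    (W : WeierstrassCurve ℚ) [W.IsElliptic] [W.IsGloballyMinimal] (p : ℕ) [Fact p.Prime]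
    (hr : W.analyticRank = 0) (hp2 : p ≠ 2) (hadd : Addv W p) (hT : SubTprime W p)
    (hI : W.HasIrreducibleModPGaloisRep p) (hns : ¬ ∀ n : ℕ, W.HasSurjectiveModNGaloisRep (p ^ n : ℕ)) :
    MissingUpperBoundAt W p := by
  by_cases hcm : W.HasCM
  · exact missingUpperBoundAt_of_hasCM_rankZero hCM hmod hGZK W p hr hcm
  · by_cases h3 : p = 3
    · subst h3
      exact hns3 W hr hadd hT hcm hI (not_hasSurjectiveModNGaloisRep_nine_of_not_towerSurj W hns)
    · have h5 : 5 ≤ p := five_le_of_prime_of_ne_two_of_ne_three Fact.out hp2 h3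
      exact hns5 W p hr h5 hadd hT hcm hI
        (not_hasSurjectiveModNGaloisRep_of_not_towerSurj W p h5 hns)

/-- **RESHAPED COMPOSITION of the row crux `TameUpperNonsurjTower` BY NAME** (for the tenure
planner): granted the CM triple (Rubin 1991 / Burungale–Flach 2024 Cor. 2), modularity and GZK, the
crux follows from (i) the upper half on the NON-CM rank-`0` (t′) rows at `p ≥ 5` with `E[p]`
irreducible and `ρ̄_{E,p}` not onto and (ii) the same at `p = 3` with `E[3]` irreducible and `ρ̄_{E,9}`
not onto. Term = `tameUpperNonsurj_of_cm_of_modP_of_modNine`; nothing about (i), (ii) or the named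
facts is asserted (conditional: the item is NOT closed by this theorem).
[cite: SerreAbelianLadic1968, Ch. IV §3.4 Lemma 3 (IV-23)] [cite: BurungaleFlach2024, Thm. 1.1 and Cor. 2 (p. 4)] -/
theorem tameUpperNonsurjTower_of_cm_of_modP_of_modNine (hCM : bsdTriple_of_hasCM_of_L_one_ne_zero)
    (hmod : hasEntireLFunction_rat) (hGZK : rank_eq_analyticRank_of_analyticRank_le_one)
    (hns5 : ∀ (W : WeierstrassCurve ℚ) [W.IsElliptic] [W.IsGloballyMinimal] (p : ℕ) [Fact p.Prime],
      W.analyticRank = 0 → 5 ≤ p → Addv W p → SubTprime W p → ¬ W.HasCM →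
      W.HasIrreducibleModPGaloisRep p → ¬ W.HasSurjectiveModNGaloisRep p → MissingUpperBoundAt W p)
    (hns3 : ∀ (W : WeierstrassCurve ℚ) [W.IsElliptic] [W.IsGloballyMinimal] [Fact (Nat.Prime 3)],
      W.analyticRank = 0 → Addv W 3 → SubTprime W 3 → ¬ W.HasCM →
      W.HasIrreducibleModPGaloisRep 3 → ¬ W.HasSurjectiveModNGaloisRep 9 → MissingUpperBoundAt W 3) :
    Summit.BirchSwinnertonDyer.BirchSwinnertonDyer.Theses.KatoDescentTamePotSupersingular.TameUpperNonsurjTower := by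
  intro W _ _ p _ hr hp2 hadd hT hI hns
  exact tameUpperNonsurj_of_cm_of_modP_of_modNine hCM hmod hGZK hns5 hns3 W p hr hp2 hadd hT hI hns

end Summit.BirchSwinnertonDyer.BirchSwinnertonDyer.Theorems

end
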